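/-
Copyright (c) 2026. All rights reserved.
Released under Apache 2.0 license as described in the file LICENSE.
Authors: abc-iut cell, fact-proving seat abc-iut-f-102 (block F, tranche 102).
-/
import Literature.AnabelianGeometry.AbsoluteAnabelian.LogFrobeniusShiftActionDiagonalCompat
import Literature.AnabelianGeometry.AbsoluteAnabelian.LogFrobeniusCor55FamiliesDiagonal
import Literature.AnabelianGeometry.AbsoluteAnabelian.LogFrobeniusCoreRigidCalibration
import Literature.AnabelianGeometry.AbsoluteAnabelian.LogFrobeniusRigidityProofs
import HarnessLib

/-!
# [AbsTopIII] Corollary 5.5 (v) at the diagonal setting, part 2: the typed `ℤ`-action clause HOLDS there (instance forms of FACT-LIST rows F-0157 / F-0156)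

S. Mochizuki, *Topics in absolute anabelian geometry III: global reconstruction algorithms*,
J. Math. Sci. Univ. Tokyo 22 (2015) 939–1156 [MochizukiAbsTopIII2015]; locators `p.N` = pages of the
author's manuscript (`paper:url-5493eb38cbb7`): Def 3.5 (ii), (iii), (v) pp. 75–77 (families of homotopies, cores,
1-morphisms and their compatibility with families of homotopies), Cor 5.5 (i) p. 130, (iii) p. 131, (v) pp. 131–133
(proof p. 133: "the remainder of assertion (v) is immediate from the definitions and constructions made thus far").

PROOF-ONLY companion (no `def`, nothing restated) of `LogFrobeniusRigidity.lean` (abc-iut-L4-t3: `Cor55ShiftAction` = F-0157,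
`Cor55Rigidity` = F-0156, `RealisesCor55Families` = F-0159), of abc-iut-w5-d112's `LogFrobeniusRigidityProofs.lean`
(`cor55ShiftAction_iff`, `shiftOneMorphism_iso_eq`) and of abc-iut-w4-d095's `LogFrobeniusLogWallIndependence.lean` /
`LogFrobeniusCor55FamiliesDiagonal.lean` (the DIAGONAL setting `diagonal Vmod isArc C` on a large category `C` — every row
`C`, every structure functor `𝟭 C`, every 2-cell an identity — with its family of strict commutations `diagonalFamily` of
ALL co-verticial pairs of `D•⊢`, which REALISES the cores of Cor 5.5 (i) and the observables of Cor 5.5 (iii) for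
`V(F_mod) ≠ ∅`: `diagonal_realisesCor55Families`, the instance form of F-0159).  Contents:

* (toolkit used: this seat's `DiagramMorphismPathIso.lean` — the isomorphisms `Φ_{[γ]}` of a 1-morphism along paths with
  `eqToHom` components for strictly commuting 1-morphisms — and `LogFrobeniusShiftActionInvariance.lean` — the shift of
  `Γ⃗_{D•⊢}` is surjective on paths, `DVertex.shiftGraph_mapPath_cast`; compatibility = shift-invariance);
* (part 1, `LogFrobeniusShiftActionDiagonalCompat.lean`: `nonempty_diagonalShiftCompatibleWith k` — every shift is compatible
  (Def 3.5 (v)) with `diagonalFamily`);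
* `diagonal_cor55ShiftAction` — F-0157 HOLDS at the diagonal setting for `V(F_mod) ≠ ∅` (clause (3) of `Cor55ShiftAction`:
  w4-d095's `diagonal_realisesCor55Families` + `nonempty_diagonalShiftCompatibleWith`; clauses (1)–(2) for every setting by
  w5-d112); `diagonal_cor55Rigidity_iff` (F-0156 holds there iff `C` is id-rigid, e.g. `C = Type u`, w4-d095's
  `isIdRigid_type`), and the existence statements `exists_cor55ShiftAction` / `exists_cor55Rigidity`, each `↔ Nonempty Vmod`
  (`…_iff_nonempty`; the only-if through w4-d095's `exists_realisesCor55Families_iff_nonempty`, i.e. abc-iut-L4-t15's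
  `cor55Cores_iff_nonempty`).

With `LogFrobeniusShiftActionNecessity.lean` / `LogFrobeniusShiftActionIotaIso.lean` (this seat: the rows FAIL over the
empty index set and at the zero-twisted setting over every nonempty one) this completes the kernel status of F-0156 /
F-0157 (and, with w4-d095's file, F-0159): INDEPENDENT of the interface `LogFrobeniusSetting`, satisfiable exactly when `V(F_mod) ≠ ∅`; R5 —
consumable at NAMED instances only.  HONEST LABEL: the diagonal setting is a DEGENERATE calibration device (no arithmetic
content); "holds at the diagonal setting" certifies consistency of the typed statement with the interface, nothing about
print's `Th•_T[Z]`.  Refereed pre-IUT anabelian geometry; nothing here bears on [IUTchIII] Cor. 3.12; typed ≠ proved.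
-/

set_option autoImplicit false

universe u

open CategoryTheory Quiver

namespace Literature.AnabelianGeometry.AbsoluteAnabelian

namespace LogFrobeniusSetting

open DiagramOfCategories

variable (Vmod : Type u) (isArc : Vmod → Bool) (C : Type (u + 1)) [Category.{u} C]

/-! ## Cor 5.5 (v) at the diagonal setting -/

/-- **F-0157 at the diagonal setting**: for `V(F_mod) ≠ ∅` the typed Cor 5.5 (v), third clause — every shift is an
equivalence, group law, and compatibility with ONE family realising the cores of (i) and the observables of (iii) — HOLDS
at the diagonal setting (clauses (1)–(2) for every setting by abc-iut-w5-d112's `cor55ShiftAction_iff`; clause (3) by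
abc-iut-w4-d095's `diagonal_realisesCor55Families` and `nonempty_diagonalShiftCompatibleWith`).  DEGENERATE calibration
instance.
[cite: MochizukiAbsTopIII2015, Cor 5.5 (v) p. 132] -/
theorem diagonal_cor55ShiftAction [Nonempty Vmod] : (diagonal Vmod isArc C).Cor55ShiftAction :=
  (diagonal Vmod isArc C).cor55ShiftAction_iff.mpr
    ⟨_, diagonal_realisesCor55Families Vmod isArc C, fun k => nonempty_diagonalShiftCompatibleWith Vmod isArc C k⟩

/-- **F-0156 at the diagonal setting**: for `V(F_mod) ≠ ∅`, Cor 5.5 (v) as one node holds at the diagonal setting on `C` iff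
`C` is id-rigid (total `□`-rigidity = id-rigidity of `𝒳 = C`, abc-iut-w5-d112's `cor55CoreRigid_iff`).
[cite: MochizukiAbsTopIII2015, Cor 5.5 (v) p. 131] -/
theorem diagonal_cor55Rigidity_iff [Nonempty Vmod] : (diagonal Vmod isArc C).Cor55Rigidity ↔ IsIdRigid C :=
  ⟨fun h => (diagonal_cor55CoreRigid_iff Vmod isArc C).mp h.1,
    fun hC => ⟨(diagonal_cor55CoreRigid_iff Vmod isArc C).mpr hC, diagonal_cor55ShiftAction Vmod isArc C⟩⟩

/-! ## Existence over an index set: exactly when it is nonempty -/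

/-- **F-0157 is satisfiable over every NONEMPTY index set** (the diagonal setting on `Type u`).
[cite: MochizukiAbsTopIII2015, Cor 5.5 (v) p. 132] -/
theorem exists_cor55ShiftAction [Nonempty Vmod] : ∃ L : LogFrobeniusSetting Vmod isArc, L.Cor55ShiftAction :=
  ⟨_, diagonal_cor55ShiftAction Vmod isArc (Type u)⟩

/-- **F-0156 is satisfiable over every NONEMPTY index set**: the diagonal setting on the id-rigid large category `Type u`
(abc-iut-w4-d095's `isIdRigid_type`). [cite: MochizukiAbsTopIII2015, Cor 5.5 (v) p. 131] -/
theorem exists_cor55Rigidity [Nonempty Vmod] : ∃ L : LogFrobeniusSetting Vmod isArc, L.Cor55Rigidity :=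
  ⟨_, (diagonal_cor55Rigidity_iff Vmod isArc (Type u)).mpr isIdRigid_type⟩

/-- **Over a given index set, F-0157 is satisfiable iff the index set is nonempty.** [cite: MochizukiAbsTopIII2015, Cor 5.5 (v) p. 132] -/
theorem exists_cor55ShiftAction_iff_nonempty :
    (∃ L : LogFrobeniusSetting Vmod isArc, L.Cor55ShiftAction) ↔ Nonempty Vmod := by
  refine ⟨fun ⟨L, hL⟩ => ?_, fun ⟨v⟩ => ?_⟩
  · obtain ⟨K, hK, -⟩ := L.cor55ShiftAction_iff.mp hL
    exact (exists_realisesCor55Families_iff_nonempty Vmod isArc).mp ⟨L, K, hK⟩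
  · haveI : Nonempty Vmod := ⟨v⟩
    exact exists_cor55ShiftAction Vmod isArc

/-- **Over a given index set, F-0156 is satisfiable iff the index set is nonempty.** [cite: MochizukiAbsTopIII2015, Cor 5.5 (v) p. 131] -/
theorem exists_cor55Rigidity_iff_nonempty :
    (∃ L : LogFrobeniusSetting Vmod isArc, L.Cor55Rigidity) ↔ Nonempty Vmod := by
  refine ⟨fun ⟨L, hL⟩ => ?_, fun ⟨v⟩ => ?_⟩
  · obtain ⟨K, hK, -⟩ := L.cor55ShiftAction_iff.mp hL.2
    exact (exists_realisesCor55Families_iff_nonempty Vmod isArc).mp ⟨L, K, hK⟩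
  · haveI : Nonempty Vmod := ⟨v⟩
    exact exists_cor55Rigidity Vmod isArc

end LogFrobeniusSetting

end Literature.AnabelianGeometry.AbsoluteAnabelian
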